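import Summits.QuantumFields.YangMills.Theorems.ParabolicTrajectoryLatticeGapOnTrajectoryTrisectionGapMin

/-!
# Route-context READ-BACK of banner (c′) (crux stmt-QuantumFields-10523, lead c9): children V / I / U_gap, (B) restated pure-lattice, rev-8 `closes` one-liners

Mirrors the (A) chain's `Cruxes/ContinuumLimitOnTrajectory/SplitDefeqCheck.lean`: imports what the route file
`Theses/ParabolicTrajectory.lean` would import after the edit, replicates its `open` lines, renders the statements VERBATIM as
one-line Props with an `open … in` prefix inside the route namespace (exactly the texts of `RESTATE-B-c9.md` / `restate_texts.json`),
and proves by `Iff.rfl` that they are the Theorems-side names, then that the `--glue-by` and `--closes-file` one-liners typecheck.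
Scratch (not landed). Expected: rc 0, 0 sorry.
-/

namespace Summit.QuantumFields.YangMills.Theses.ParabolicTrajectory.SplitScratchB

open scoped BigOperators Topology Manifold Classical MeasureTheory ProbabilityTheory Matrix InnerProductSpace ComplexConjugate ContinuousMap
open Filter Set Function TopologicalSpace MeasureTheory

/-- child I (route-item rendering; identical to the (A) chain's children.json). -/
def ClusteringOnTrajectory : Prop :=
  open Literature.MathematicalPhysics.QuantumFieldTheory Literature.MathematicalPhysics.QuantumLattice Literature.MathematicalPhysics.AQFT Classical in ∀ (G : Type) [Group G] [TopologicalSpace G] [IsTopologicalGroup G] [CompactSpace G] [MeasurableSpace G] [BorelSpace G], IsCompactSimpleLieGroup G → ∀ (r : LatticeRep G) (M : ℕ) (θ Δ : ℝ) (sch : SpeciesScheme (YMSpecies G)) (n : ℕ → ℕ), 0 < θ → 0 < Δ → (∀ k, sch.a k = ((M : ℝ) ^ n k)⁻¹) → Filter.Tendsto sch.β Filter.atTop Filter.atTop → (∀ t : ℕ, 0 < t → ∃ c : ℝ, Filter.Tendsto (fun k => ((M : ℝ) ^ n k) ^ 8 * latticeConnectedCorr r.ρ (sch.β k) (sch.side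 k) r.curvature.F r.curvature.F (t * M ^ n k)) Filter.atTop (nhds c)) → Filter.Tendsto (fun k => ((M : ℝ) ^ n k) ^ 8 * latticeConnectedCorr r.ρ (sch.β k) (sch.side k) r.curvature.F r.curvature.F (M ^ n k)) Filter.atTop (nhds θ) → HasLatticeMassGap r sch Δ → (∃ N : ℕ, 1 ≤ N ∧ ∀ᶠ k in Filter.atTop, (sch.a k)⁻¹ ≤ (sch.a k * (sch.L k : ℝ)) ^ N) → let cn : SpeciesScheme (YMSpecies G) := { a := sch.a, a_pos := sch.a_pos, tendsto_a := sch.tendsto_a, β := sch.β, L := sch.L, tendsto_L := sch.tendsto_L, c := fun s k => if s = r.curvature then ((sch.a k) ^ 4)⁻¹ else 0, m := fun s k => wilsonTorusMean r.ρ (sch.β k) (sch.L k) s.F }; ((∀ (p : ℕ) (f : Fin p → SchwartzMap (EuclideanSpace ℝ (Fin 4)) ℝ), IsOffDiagonal (SchwartzMap.tensorFin p fun i => ofRealTest (f i)) → ∀ ε : ℝ, 0 < ε → ∀ᶠ k in Filter.atTop, ∀ L : ℕ, sch.L k ≤ L → |latticeSchwinger r.ρ cn (fun s => s.F) k p (fun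 _ => r.curvature) f - wilsonCentredSchwinger r.ρ (sch.β k) L (fun _ => 1) p (fun _ => r.curvature) (fun i => (blockDilate M)^[n k] (f i))| ≤ ε) ∧ (∀ t : ℕ, 0 < t → ∀ ε : ℝ, 0 < ε → ∀ᶠ k in Filter.atTop, ∀ S : ℕ, sch.L k ≤ S → ((M : ℝ) ^ n k) ^ 8 * |latticeConnectedCorr r.ρ (sch.β k) (sch.side k) r.curvature.F r.curvature.F (t * M ^ n k) - latticeConnectedCorr r.ρ (sch.β k) (2 * S + 1) r.curvature.F r.curvature.F (t * M ^ n k)| ≤ ε)) ∧ ∃ Δ₁ : ℝ, 0 < Δ₁ ∧ SpeciesScheme.HasCSClustering r cn Δ₁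

/-- child U in GAP CURRENCY (route-item rendering; replaces the (A) chain's child U). -/
def UltravioletLimitWithGapOnTrajectory : Prop :=
  open Literature.MathematicalPhysics.QuantumFieldTheory Literature.MathematicalPhysics.QuantumLattice Literature.MathematicalPhysics.AQFT Classical in ∀ (G : Type) [Group G] [TopologicalSpace G] [IsTopologicalGroup G] [CompactSpace G] [MeasurableSpace G] [BorelSpace G], IsCompactSimpleLieGroup G → ∀ (r : LatticeRep G), ∃ M₀ : ℕ, ∀ M : ℕ, M₀ ≤ M → 2 ≤ M → ∃ θ₀ : ℝ, 0 < θ₀ ∧ ∀ (θ Δ : ℝ) (sch : SpeciesScheme (YMSpecies G)) (n : ℕ → ℕ), 0 < θ → θ < θ₀ → 0 < Δ → (∀ k, sch.a k = ((M : ℝ) ^ n k)⁻¹) → Filter.Tendsto sch.β Filter.atTop Filter.atTop → (∀ t : ℕ, 0 < t → ∃ c : ℝ, Filter.Tendsto (fun k => ((M : ℝ) ^ n k) ^ 8 * latticeConnectedCorr r.ρ (sch.β k) (sch.side k) r.curvature.F r.curvature.F (t * M ^ n k)) Filter.atTop (nhds c)) → Filter.Tendsto (fun k => ((M : ℝ)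 ^ n k) ^ 8 * latticeConnectedCorr r.ρ (sch.β k) (sch.side k) r.curvature.F r.curvature.F (M ^ n k)) Filter.atTop (nhds θ) → HasLatticeMassGap r sch Δ → (∃ N : ℕ, 1 ≤ N ∧ ∀ᶠ k in Filter.atTop, (sch.a k)⁻¹ ≤ (sch.a k * (sch.L k : ℝ)) ^ N) → let cn : SpeciesScheme (YMSpecies G) := { a := sch.a, a_pos := sch.a_pos, tendsto_a := sch.tendsto_a, β := sch.β, L := sch.L, tendsto_L := sch.tendsto_L, c := fun s k => if s = r.curvature then ((sch.a k) ^ 4)⁻¹ else 0, m := fun s k => wilsonTorusMean r.ρ (sch.β k) (sch.L k) s.F }; ((∀ (p : ℕ) (f : Fin p → SchwartzMap (EuclideanSpace ℝ (Fin 4)) ℝ), IsOffDiagonal (SchwartzMap.tensorFin p fun i => ofRealTest (f i)) → ∀ ε : ℝ, 0 < ε → ∀ᶠ k in Filter.atTop, ∀ L : ℕ, sch.L k ≤ L → |latticeSchwinger r.ρ cn (fun s => s.F) k p (fun _ => r.curvature) f - wilsonCentredSchwinger r.ρ (sch.β k) L (fun _ => 1) p (fun _ => r.curvature) (fun i =>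 (blockDilate M)^[n k] (f i))| ≤ ε) ∧ (∀ t : ℕ, 0 < t → ∀ ε : ℝ, 0 < ε → ∀ᶠ k in Filter.atTop, ∀ S : ℕ, sch.L k ≤ S → ((M : ℝ) ^ n k) ^ 8 * |latticeConnectedCorr r.ρ (sch.β k) (sch.side k) r.curvature.F r.curvature.F (t * M ^ n k) - latticeConnectedCorr r.ρ (sch.β k) (2 * S + 1) r.curvature.F r.curvature.F (t * M ^ n k)| ≤ ε)) → (∃ Δ₁ : ℝ, 0 < Δ₁ ∧ SpeciesScheme.HasCSClustering r cn Δ₁) → ∃ sch' : SpeciesScheme (YMSpecies G), sch'.a = sch.a ∧ sch'.β = sch.β ∧ sch'.L = sch.L ∧ ∃ T : OSData (YMSpecies G) 4, IsYangMillsFor r sch' T ∧ T.IsNontrivial r.curvature ∧ T.IsNonGaussian r.curvature ∧ ∃ Δ₁ : ℝ, 0 < Δ₁ ∧ T.HasMassGap Δ₁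

/-- (B) restated: the pure-lattice Sub₁ (route-item rendering of `Split.LatticeGapOnTrajectoryLat`). -/
def LatticeGapOnTrajectoryLat : Prop :=
  open Literature.MathematicalPhysics.QuantumFieldTheory Literature.MathematicalPhysics.QuantumLattice Literature.MathematicalPhysics.AQFT Classical in ∀ (G : Type) [Group G] [TopologicalSpace G] [IsTopologicalGroup G] [CompactSpace G] [MeasurableSpace G] [BorelSpace G], IsCompactSimpleLieGroup G → ∀ (r : LatticeRep G) (M : ℕ) (θ : ℝ) (sch : SpeciesScheme (YMSpecies G)) (n : ℕ → ℕ), 2 ≤ M → 0 < θ → (∀ k, sch.a k = ((M : ℝ) ^ n k)⁻¹) → Filter.Tendsto sch.β Filter.atTop Filter.atTop → Filter.Tendsto (fun k => ((M : ℝ) ^ n k) ^ 8 * latticeConnectedCorr r.ρ (sch.β k) (sch.side k) r.curvature.F r.curvature.F (M ^ n k)) Filter.atTop (nhds θ) → ∃ Δ : ℝ, 0 < Δ ∧ HasLatticeMassGap r sch Δ ∧ Summit.QuantumFields.YangMills.Cruxes.LatticeGapOnTrajectory.OrbitKantorovichFiniteSize.Transfer.UniformSlabClustering r sch Δ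

/-- (B) restated, minimal alternative (route-item rendering of `TrisectionGap.LatticeGapOnTrajectoryMin`). -/
def LatticeGapOnTrajectoryMin : Prop :=
  open Literature.MathematicalPhysics.QuantumFieldTheory Literature.MathematicalPhysics.QuantumLattice Literature.MathematicalPhysics.AQFT Classical in ∀ (G : Type) [Group G] [TopologicalSpace G] [IsTopologicalGroup G] [CompactSpace G] [MeasurableSpace G] [BorelSpace G], IsCompactSimpleLieGroup G → ∀ (r : LatticeRep G) (M : ℕ) (θ : ℝ) (sch : SpeciesScheme (YMSpecies G)) (n : ℕ → ℕ), 2 ≤ M → 0 < θ → (∀ k, sch.a k = ((M : ℝ) ^ n k)⁻¹) → Filter.Tendsto sch.β Filter.atTop Filter.atTop → Filter.Tendsto (fun k => ((M : ℝ) ^ n k) ^ 8 * latticeConnectedCorr r.ρ (sch.β k) (sch.side k) r.curvature.F r.curvature.F (M ^ n k)) Filter.atTop (nhds θ) → ∃ Δ : ℝ, 0 < Δ ∧ HasLatticeMassGap r sch Δ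

/-- (S) restated with the volume clause (route-item rendering of `TwoOrbitSynchronisation.TunedSequenceExistsPVG`, the (A) chain's banner (b)). -/
def TunedSequenceExistsPVG : Prop :=
  open Literature.MathematicalPhysics.QuantumFieldTheory Literature.MathematicalPhysics.QuantumLattice Literature.MathematicalPhysics.AQFT Classical in ∀ (G : Type) [Group G] [TopologicalSpace G] [IsTopologicalGroup G] [CompactSpace G], IsCompactSimpleLieGroup G → letI : MeasurableSpace G := borel G; haveI : BorelSpace G := ⟨rfl⟩; ∀ (r : LatticeRep G) (M : ℕ), 2 ≤ M → ∃ θ₀ : ℝ, 0 < θ₀ ∧ ∀ θ : ℝ, 0 < θ → θ < θ₀ → ∃ (sch : SpeciesScheme (YMSpecies G)) (n : ℕ → ℕ), (∀ k, sch.a k = ((M : ℝ) ^ n k)⁻¹) ∧ Filter.Tendsto sch.β Filter.atTop Filter.atTop ∧ (∀ t : ℕ, 0 < t → ∃ c : ℝ, Filter.Tendsto (fun k => ((M : ℝ) ^ n k) ^ 8 * latticeConnectedCorr r.ρ (sch.β k) (sch.side k) r.curvature.F r.curvature.F (t * M ^ n k)) Filter.atTop (nhds c)) ∧ Filter.Tendsto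 (fun k => ((M : ℝ) ^ n k) ^ 8 * latticeConnectedCorr r.ρ (sch.β k) (sch.side k) r.curvature.F r.curvature.F (M ^ n k)) Filter.atTop (nhds θ) ∧ (∃ N : ℕ, 1 ≤ N ∧ ∀ᶠ k in Filter.atTop, (sch.a k)⁻¹ ≤ (sch.a k * (sch.L k : ℝ)) ^ N)

open Summit.QuantumFields.YangMills.Cruxes.ContinuumLimitOnTrajectory in
/-- defeq read-back I -/
theorem i_iff : ClusteringOnTrajectory ↔ RegimeTrisection.ClusteringOnTrajectory := Iff.rfl

open Summit.QuantumFields.YangMills.Cruxes.LatticeGapOnTrajectory in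
/-- defeq read-back U_gap -/
theorem ugap_iff : UltravioletLimitWithGapOnTrajectory ↔ TrisectionGap.UltravioletLimitWithGapOnTrajectory := Iff.rfl

open Summit.QuantumFields.YangMills.Cruxes.LatticeGapOnTrajectory.OrbitKantorovichFiniteSize in
/-- defeq read-back B_Lat -/
theorem blat_iff : LatticeGapOnTrajectoryLat ↔ Split.LatticeGapOnTrajectoryLat := Iff.rfl

open Summit.QuantumFields.YangMills.Cruxes.LatticeGapOnTrajectory in
/-- defeq read-back B_Min -/
theorem bmin_iff : LatticeGapOnTrajectoryMin ↔ TrisectionGap.LatticeGapOnTrajectoryMin := Iff.rfl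

open Summit.QuantumFields.YangMills.Cruxes.ContinuumLimitOnTrajectory in
/-- defeq read-back S_PVG -/
theorem spvg_iff : TunedSequenceExistsPVG ↔ TwoOrbitSynchronisation.TunedSequenceExistsPVG := Iff.rfl

open Summit.QuantumFields.YangMills.Cruxes.ContinuumLimitOnTrajectory Summit.QuantumFields.YangMills.Cruxes.LatticeGapOnTrajectory in
/-- the split glue of (A) with child U in gap currency: `V → I → U_gap → ContinuumLimitOnTrajectory` (the `--glue-by` term) -/
theorem glue_by_gap : RegimeTrisection.ForcedVolumeGrowth → ClusteringOnTrajectory → UltravioletLimitWithGapOnTrajectory →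
    ContinuumLimitOnTrajectory :=
  fun hV hI hU => RegimeTrisection.ContinuumLimitOnTrajectory_of_subs hV hI (TrisectionGap.ultravioletLimitOnTrajectory_of_withGap hU)

open Summit.QuantumFields.YangMills.Cruxes.LatticeGapOnTrajectory in
/-- the rev-8 `closes` one-liner of banner (c′) typechecks: (B) as the pure-lattice Sub₁ -/
theorem closes8gap : UltravioletLimitWithGapOnTrajectory → ClusteringOnTrajectory → LatticeGapOnTrajectoryLat →
    TunedSequenceExistsPVG → YangMills :=
  TrisectionGap.yangMills_of_trisectionGap

open Summit.QuantumFields.YangMills.Cruxes.LatticeGapOnTrajectory in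
/-- the rev-8 `closes` one-liner with the MINIMAL (B) typechecks -/
theorem closes8gapMin : UltravioletLimitWithGapOnTrajectory → ClusteringOnTrajectory → LatticeGapOnTrajectoryMin →
    TunedSequenceExistsPVG → YangMills :=
  TrisectionGap.yangMills_of_trisectionGapMin

open Summit.QuantumFields.YangMills.Cruxes.LatticeGapOnTrajectory in
/-- and (B) restated is a weakening of (B) as filed (nothing is lost): -/
theorem bmin_of_filed : LatticeGapOnTrajectory → LatticeGapOnTrajectoryMin := TrisectionGap.latticeGapOnTrajectoryMin_of_filed

end Summit.QuantumFields.YangMills.Theses.ParabolicTrajectory.SplitScratchB
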